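import Literature.AlgebraicGeometry.HodgeTheory.AlgFormExprCalculus
import Literature.AlgebraicGeometry.HodgeTheory.AnalyticModelRealizePullback
import Literature.AlgebraicGeometry.HodgeTheory.ConjugationChartExistence
import Literature.AlgebraicGeometry.Motives.AffineAlgebraicDeRham
import Literature.AlgebraicGeometry.Motives.AlgPointsProperProofs
import Literature.Geometry.Kaehler.ConnectionExists
import HarnessLib

/-!
# The holomorphic image of a regular algebraic form (Grothendieck's comparison map)

[topic AlgebraicGeometry/HodgeTheory]

Let `Y` be an affine `ℂ`-scheme with an analytic model `A : AnalyticModel E m Y` (the complex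
manifold `Y^an`, `Literature.AlgebraicGeometry.HodgeTheory.AnalyticModel`), and let
`x : Fin N → Γ(Y, 𝒪_Y)` be global sections ("coordinates"), i.e. a morphism of `ℂ`-algebras
`φ_x : ℂ[T₁, …, T_N] → Γ(Y, 𝒪_Y)`, `Tᵢ ↦ xᵢ` (`coordPresentation`; for `Y` of finite type a
SURJECTIVE such `φ_x` exists, `AlgPoints.exists_surjective_aeval`, and then `Y ≅ V(ker φ_x) ⊆ 𝔸ᴺ`).
Grothendieck [Grothendieck1966, p. 96, (4)–(5)] compares the algebraic de Rham complex
`Γ(Y, Ω•_{Y/ℂ})` — for affine `Y` "what one might naively think", the complex of global regular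
forms, loc. cit. (4) — with the holomorphic (and then smooth) de Rham complex of `Y^an` through
*"the holomorphic image of an algebraic form"*: a regular `p`-form `Σ_J f_J dx_J` is read as the
holomorphic form with the same expression on `Y^an`, and (5) is the induced map
`H•(Γ(Y, Ω•_{Y/ℂ})) → H•(Y^an, ℂ)`; Theorem 1′ ibid. says that (5) is bijective for `Y` smooth.

This file constructs that map on the tree's two existing concrete carriers and proves that it is
a morphism of complexes:

* the ALGEBRAIC side is `Literature.AlgebraicGeometry.Motives.AffineDeRham`: polynomial forms
  `PolyForm ℂ N p = Ω^p_{ℂ[T]/ℂ}`, their quotient `RegularForm I p = Ω^p_{(ℂ[T]/I)/ℂ}` by the forms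
  vanishing on `V(I)`, the differential `RegularForm.d`, and `DeRhamCohomology I p`;
* the ANALYTIC side is the tree's smooth complex forms `MForm 𝓘(ℝ, E) A.carrier ℂ p` with
  `mextDeriv`, `cclosedSmoothForms` / `cexactSmoothForms` and `complexDeRhamCohomology`;
* in between sits the SYMBOLIC carrier `AlgFormExpr Y p` of
  `Literature.AlgebraicGeometry.HodgeTheory.AbsoluteHodgeClasses` (formal sums
  `Σⱼ fⱼ dg_{j,1} ∧ ⋯ ∧ dg_{j,p}` with `fⱼ, g_{j,i} ∈ Γ(Y, 𝒪)`) and its realisation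
  `AlgFormExpr.realize A` on `Y^an`, in terms of which the named fact
  `grothendieck_comparison_realize_surjective` ((G) of the conjugation-chart programme) is stated.

Main definitions and results (all sorry-free; no named facts are introduced):

* `AnalyticModel.regularFunRingHom` — `s ↦ s^an`, `Γ(Y, 𝒪) →+* (Y^an → ℂ)`, scalars to constants
  (`regularFun_scalarRingHom`), and `regularFun_coordPresentation`:
  `(φ_x f)^an = f(x₁^an, …, x_N^an)`.
* `rawRealize A x p` / `polyFormRealize A x p : PolyForm ℂ N p →ₗ[ℂ] MForm 𝓘(ℝ, E) A.carrier ℂ p` —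
  the holomorphic image `α ↦ Σ_t (p!)⁻¹ (φ_x α(e_t))^an · dx_{t₁}^an ∧ ⋯ ∧ dx_{t_p}^an`, the sum
  over ALL `p`-tuples `t` (each increasing `J` is hit `p!` times with the same term, by alternation
  of both factors; this normal form avoids choosing increasing representatives; `rawRealize` is
  the sum without the factor `(p!)⁻¹`), `ℂ`-linear and `ℂ[T]`-semilinear (`polyFormRealize_smul`);
* `PolyForm.toAlgFormExpr x α : AlgFormExpr Y p` with
  `realize_toAlgFormExpr : (toAlgFormExpr x α).realize A = polyFormRealize A x p α` — the bridge
  between the symbolic carrier and Kähler forms;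
* `dFun_regularFun_coordPresentation` — the CHAIN RULE
  `d (φ_x f)^an = Σ_l (φ_x ∂f/∂T_l)^an · d x_l^an`;
* `polyFormRealize_extDeriv` — the holomorphic image is a COCHAIN MAP,
  `polyFormRealize (dω) = d (polyFormRealize ω)`
  (chain rule, `d(f · dg₁ ∧ ⋯) = df ∧ dg₁ ∧ ⋯`, and the alternation of iterated wedges under the
  cycles `Fin.cycleRange i`, whose signs cancel the signs of the alternatised formula for `dω`);
* `polyFormRealize_eq_zero_of_mem_vanishingForms` — forms vanishing on `V(I)`, `I ⊆ ker φ_x`,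
  have zero image; hence `regularFormRealize : RegularForm I p →ₗ[ℂ] MForm …` commuting with `d`
  (`regularFormRealize_d`), sending closed forms to closed smooth forms and exact to exact;
* `deRhamComparison A x hI p : DeRhamCohomology I p →ₗ[ℂ] complexDeRhamCohomology E A.carrier p`
  — Grothendieck's map (5); and `exists_realize_eq_of_deRhamComparison_surjective`: if (5) is
  surjective for some coordinates then every complex de Rham class of `Y^an` is the class of the
  realisation of an algebraic form expression — the conclusion of
  `grothendieck_comparison_realize_surjective` for `(Y, A)` — which is how Theorem 1′ feeds (G)
  (`grothendieck_comparison_realize_surjective_of_deRhamComparison`).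
* `polyFormRealize_dWedge` — `(df ∧ η)^an = d(φ_x f)^an ∧ η^an` (wedge compatibility, from the
  cochain property and the two Leibniz rules); `polyWedge` / `polyFormRealize_polyWedge` — the
  polynomial form `da₀ ∧ ⋯ ∧ da_{k-1}` realises to `HodgeTheory.dWedge`; and
  `exists_polyFormRealize_eq_realize`: for `φ_x` SURJECTIVE every `AlgFormExpr` realisation is
  the holomorphic image of a polynomial (or regular) form — so the realisations of expressions
  are exactly the images of `Γ(V(ker φ_x), Ω^p)` [Grothendieck1966, (4)].

Typing note: fibrewise identities between iterated wedges are stated on the MODEL space `E`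
(`AnalyticModel.dAt`, `coordTupleAt`): the tangent space at a point is `E` only up to unfolding
instances, and Mathlib's alternating-map lemmas (`AlternatingMap.map_perm`,
`MultilinearMap.cons_add`) do not unify through `TangentSpace`.

What is NOT here: Theorem 1′ itself (bijectivity of (5) for smooth `Y`: this needs Serre's GAGA /
Cartan B on `Y^an` or resolution of singularities, loc. cit. p. 96–97), and the identification of
`RegularForm (ker φ_x) 1` with Mathlib's `Ω[Γ(Y, 𝒪)⁄ℂ]` (`KaehlerDifferential`; conormal sequence).

## References

* [Grothendieck1966] A. Grothendieck, *On the de Rham cohomology of algebraic varieties*,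
  Publ. Math. IHÉS 29 (1966) 95–103: p. 96 (4) (affine case: hypercohomology = cohomology of
  global regular forms), (5) (the comparison map "holomorphic image of an algebraic form"),
  Thm 1′ (it is bijective for smooth affine `X`).
* [Warner1983] F. Warner, *Foundations of differentiable manifolds and Lie groups*, GTM 94,
  2.20 (Leibniz rule, `d ∘ d = 0`, chain rule for `d` on functions).
* [Hartshorne1977] R. Hartshorne, *Algebraic Geometry*, II.8 (Kähler differentials of a quotient,
  Prop. 8.4A), II Ex. 2.7 (values of sections at points).
-/

noncomputable section

open scoped Manifold ContDiff
open CategoryTheory AlgebraicGeometry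
open Literature.NumberTheory.Transcendental Literature.Geometry.Kaehler
open Literature.AlgebraicGeometry.Motives Literature.AlgebraicGeometry.Motives.AffineDeRham

namespace Literature.AlgebraicGeometry.HodgeTheory

section HodgeTheory

variable {E : Type} [NormedAddCommGroup E] [NormedSpace ℂ E] [FiniteDimensional ℂ E] {m : ℕ}
  {Y : Motives.SchemeOver ℂ} {N : ℕ}

/-! ### Coordinates: the presentation `ℂ[T₁, …, T_N] → Γ(Y, 𝒪)` -/

variable (Y) in
/-- The `ℂ`-algebra map `φ_x : ℂ[T₁, …, T_N] → Γ(Y, 𝒪_Y)`, `Tᵢ ↦ xᵢ`, scalars through the structure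
map `SchemeOver.scalarRingHom Y ⊤` (a presentation of `Γ(Y, 𝒪)` when surjective: Hartshorne II §3,
`AlgPoints.exists_surjective_aeval`). [cite: Hartshorne1977, II Ex. 2.7] -/
def coordPresentation (x : Fin N → Γ(Y.left, ⊤)) : MvPolynomial (Fin N) ℂ →+* Γ(Y.left, ⊤) :=
  MvPolynomial.eval₂Hom (SchemeOver.scalarRingHom Y ⊤) x

/-- `φ_x Tᵢ = xᵢ`. [cite: Hartshorne1977, II §3] -/
@[simp]
theorem coordPresentation_X (x : Fin N → Γ(Y.left, ⊤)) (i : Fin N) :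
    coordPresentation Y x (MvPolynomial.X i) = x i :=
  MvPolynomial.eval₂Hom_X' _ _ i

/-- `φ_x` on constants is the structure map. [cite: Hartshorne1977, II §3] -/
@[simp]
theorem coordPresentation_C (x : Fin N → Γ(Y.left, ⊤)) (c : ℂ) :
    coordPresentation Y x (MvPolynomial.C c) = SchemeOver.scalarRingHom Y ⊤ c :=
  MvPolynomial.eval₂Hom_C _ _ c

/-! ### Regular functions read on `Y^an` form a ring homomorphism -/

namespace AnalyticModel

variable (A : AnalyticModel E m Y)

/-- Evaluation of global sections at the complex point under `z ∈ Y^an`, as a ring homomorphism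
`Γ(Y, 𝒪) →+* ℂ` (Mathlib's `Scheme.evaluation` followed by the residue-field embedding of the
point). [cite: Hartshorne1977, II Ex. 2.7] -/
def evalRingHom (z : A.carrier) : Γ(Y.left, ⊤) →+* ℂ :=
  (Y.left.evaluation ⊤ (A.toComplexPoints z).pt trivial ≫ (A.toComplexPoints z).resHom).hom

/-- `s^an(z)` is the value of `s` at the point under `z`. [cite: Hartshorne1977, II Ex. 2.7] -/
theorem regularFun_eq_evalRingHom (s : Γ(Y.left, ⊤)) (z : A.carrier) :
    A.regularFun s z = A.evalRingHom z s := by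
  have hz : (A.toComplexPoints z).pt ∈ (⊤ : Y.left.Opens) := trivial
  simp only [AnalyticModel.regularFun]
  rw [AlgPoints.evalOrZero_of_mem _ hz]
  rfl

/-- **`s ↦ s^an` is a ring homomorphism** `Γ(Y, 𝒪_Y) →+* (Y^an → ℂ)` (pointwise: evaluation at a
point is a ring homomorphism). [cite: Hartshorne1977, II Ex. 2.7] -/
def regularFunRingHom : Γ(Y.left, ⊤) →+* (A.carrier → ℂ) where
  toFun s := A.regularFun s
  map_one' := funext fun z ↦ by rw [regularFun_eq_evalRingHom, map_one]; rfl
  map_mul' s t := funext fun z ↦ by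
    rw [Pi.mul_apply, regularFun_eq_evalRingHom, regularFun_eq_evalRingHom,
      regularFun_eq_evalRingHom, map_mul]
  map_zero' := funext fun z ↦ by rw [regularFun_eq_evalRingHom, map_zero]; rfl
  map_add' s t := funext fun z ↦ by
    rw [Pi.add_apply, regularFun_eq_evalRingHom, regularFun_eq_evalRingHom,
      regularFun_eq_evalRingHom, map_add]

/-- `regularFunRingHom` is `regularFun` (definitional). [cite: Hartshorne1977, II Ex. 2.7] -/
@[simp]
theorem regularFunRingHom_apply (s : Γ(Y.left, ⊤)) : A.regularFunRingHom s = A.regularFun s :=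
  rfl

/-- `(s + t)^an = s^an + t^an`. [cite: Hartshorne1977, II Ex. 2.7] -/
theorem regularFun_add (s t : Γ(Y.left, ⊤)) :
    A.regularFun (s + t) = fun z ↦ A.regularFun s z + A.regularFun t z := by
  rw [← regularFunRingHom_apply, map_add]
  rfl

/-- `0^an = 0`. [cite: Hartshorne1977, II Ex. 2.7] -/
theorem regularFun_zero : A.regularFun (0 : Γ(Y.left, ⊤)) = fun _ ↦ 0 := by
  rw [← regularFunRingHom_apply, map_zero]
  rfl

/-- `(s t)^an = s^an t^an` (no affineness needed). [cite: Hartshorne1977, II Ex. 2.7] -/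
theorem regularFun_mul' (s t : Γ(Y.left, ⊤)) :
    A.regularFun (s * t) = fun z ↦ A.regularFun s z * A.regularFun t z := by
  rw [← regularFunRingHom_apply, map_mul]
  rfl

/-- `(s t)^an (z) = s^an(z) t^an(z)`. [cite: Hartshorne1977, II Ex. 2.7] -/
theorem regularFun_mul_apply (s t : Γ(Y.left, ⊤)) (z : A.carrier) :
    A.regularFun (s * t) z = A.regularFun s z * A.regularFun t z := by
  rw [regularFun_mul']

/-- `1^an = 1` (no affineness needed). [cite: Hartshorne1977, II Ex. 2.7] -/
theorem regularFun_one' : A.regularFun (1 : Γ(Y.left, ⊤)) = fun _ ↦ 1 := by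
  rw [← regularFunRingHom_apply, map_one]
  rfl

/-- `(Σᵢ sᵢ)^an = Σᵢ sᵢ^an`, pointwise. [cite: Hartshorne1977, II Ex. 2.7] -/
theorem regularFun_sum {ι : Type*} (S : Finset ι) (s : ι → Γ(Y.left, ⊤)) (z : A.carrier) :
    A.regularFun (∑ i ∈ S, s i) z = ∑ i ∈ S, A.regularFun (s i) z := by
  simp only [regularFun_eq_evalRingHom, map_sum]

/-- **Scalars are read as constants**: `(c · 1)^an = c`. [cite: Hartshorne1977, II Ex. 2.7] -/
theorem regularFun_scalarRingHom (c : ℂ) :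
    A.regularFun (SchemeOver.scalarRingHom Y ⊤ c) = fun _ ↦ c := by
  funext z
  have hz : (A.toComplexPoints z).pt ∈ (⊤ : Y.left.Opens) := trivial
  simp only [AnalyticModel.regularFun]
  rw [AlgPoints.evalOrZero_of_mem _ hz, AlgPoints.eval_scalarRingHom]
  rfl

/-- **Polynomials in the coordinates are read by substitution**:
`(φ_x f)^an (z) = f(x₁^an(z), …, x_N^an(z))`. [cite: Hartshorne1977, II Ex. 2.7] -/
theorem regularFun_coordPresentation (x : Fin N → Γ(Y.left, ⊤)) (f : MvPolynomial (Fin N) ℂ)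
    (z : A.carrier) :
    A.regularFun (coordPresentation Y x f) z =
      MvPolynomial.eval (fun i ↦ A.regularFun (x i) z) f := by
  induction f using MvPolynomial.induction_on with
  | C c => rw [coordPresentation_C, regularFun_scalarRingHom, MvPolynomial.eval_C]
  | add f g hf hg => rw [map_add, regularFun_add, map_add, ← hf, ← hg]
  | mul_X f i hf =>
      rw [map_mul, regularFun_mul', map_mul, coordPresentation_X, MvPolynomial.eval_X, ← hf]

/-- `(φ_x (c f))^an = c (φ_x f)^an`. [cite: Hartshorne1977, II Ex. 2.7] -/
theorem regularFun_coordPresentation_C_mul (x : Fin N → Γ(Y.left, ⊤)) (c : ℂ)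
    (f : MvPolynomial (Fin N) ℂ) (z : A.carrier) :
    A.regularFun (coordPresentation Y x (MvPolynomial.C c * f)) z =
      c * A.regularFun (coordPresentation Y x f) z := by
  rw [map_mul, regularFun_mul', coordPresentation_C, regularFun_scalarRingHom]

end AnalyticModel

/-! ### Calculus of `dFun`: constants, sums, Leibniz, and the chain rule for polynomials -/

section DFun

variable {F : Type*} [NormedAddCommGroup F] [NormedSpace ℂ F]
  {M : Type*} [TopologicalSpace M] [ChartedSpace F M]

/-- `d` of a constant function vanishes. [cite: Warner1983, 2.20] -/
theorem dFun_const (c : ℂ) : (dFun (fun _ : M ↦ c) : MForm 𝓘(ℝ, F) M ℂ 1) = 0 :=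
  mextDeriv_ofFun_const c

/-- `d(u + v) = du + dv` for `C^∞` functions. [cite: Warner1983, 2.20] -/
theorem dFun_add {u v : M → ℂ} (hu : ContMDiff 𝓘(ℝ, F) 𝓘(ℝ, ℂ) ∞ u)
    (hv : ContMDiff 𝓘(ℝ, F) 𝓘(ℝ, ℂ) ∞ v) :
    (dFun (fun z ↦ u z + v z) : MForm 𝓘(ℝ, F) M ℂ 1) = dFun u + dFun v := by
  unfold dFun
  rw [show (MForm.ofFun 𝓘(ℝ, F) fun z ↦ u z + v z) = MForm.ofFun 𝓘(ℝ, F) u + MForm.ofFun 𝓘(ℝ, F) v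
    from MForm.ofFun_add u v]
  exact mextDeriv_add (fun z ↦ MForm.smoothAt_ofFun_of_contMDiffAt (hu z))
    (fun z ↦ MForm.smoothAt_ofFun_of_contMDiffAt (hv z))

variable [IsManifold 𝓘(ℝ, F) ∞ M]

/-- **Leibniz rule** `d(uv) = v du + u dv` for `C^∞` functions. [cite: Warner1983, 2.20] -/
theorem dFun_mul {u v : M → ℂ} (hu : ContMDiff 𝓘(ℝ, F) 𝓘(ℝ, ℂ) ∞ u)
    (hv : ContMDiff 𝓘(ℝ, F) 𝓘(ℝ, ℂ) ∞ v) :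
    (dFun (fun z ↦ u z * v z) : MForm 𝓘(ℝ, F) M ℂ 1) =
      fun z ↦ v z • (dFun u : MForm 𝓘(ℝ, F) M ℂ 1) z + u z • (dFun v : MForm 𝓘(ℝ, F) M ℂ 1) z := by
  funext z
  ext w
  unfold dFun
  rw [mextDeriv_ofFun_mul_apply (hu z) (hv z)]
  rfl

/-- `d(c u) = c du` for a constant `c` and a `C^∞` function `u`. [cite: Warner1983, 2.20] -/
theorem dFun_const_mul (c : ℂ) {u : M → ℂ} (hu : ContMDiff 𝓘(ℝ, F) 𝓘(ℝ, ℂ) ∞ u) :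
    (dFun (fun z ↦ c * u z) : MForm 𝓘(ℝ, F) M ℂ 1) = c • dFun u := by
  rw [dFun_mul contMDiff_const hu, dFun_const]
  funext z
  simp

end DFun

/-! ### The holomorphic image of a polynomial form -/

/-- The standard tuple of lattice vectors `(e_{t 0}, …, e_{t (p-1)})` indexed by `t`. [folklore] -/
def stdTuple {p : ℕ} (t : Fin p → Fin N) : Fin p → Fin N → ℤ := fun i ↦ Pi.single (t i) 1

section Realize

variable (A : AnalyticModel E m Y) (x : Fin N → Γ(Y.left, ⊤))

/-- The analytic monomial form `dx_{s 0}^an ∧ ⋯ ∧ dx_{s (k-1)}^an` on `Y^an`. [folklore] -/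
abbrev coordWedge (k : ℕ) (s : Fin k → Fin N) : MForm 𝓘(ℝ, E) A.carrier ℂ k :=
  dWedge k (fun i ↦ A.regularFun (x (s i)))

/-- The differential `(dg)_z` of a function on `Y^an` at a point, typed as an alternating map on the
MODEL space `E` (the tangent space at `z` is `E` by definition; lemmas about alternating maps on
`E`, e.g. `AlternatingMap.map_perm` for `iterWedgeAlt`, only unify at this typing). [folklore] -/
def AnalyticModel.dAt (g : A.carrier → ℂ) (z : A.carrier) : E [⋀^Fin 1]→L[ℝ] ℂ :=
  (dFun g : MForm 𝓘(ℝ, E) A.carrier ℂ 1) z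

/-- The tuple `((dx_{s 0}^an)_z, …, (dx_{s (k-1)}^an)_z)` of differentials at `z`, as alternating
maps on the model space `E` (the tangent space at `z` is `E` by definition; this typing is the one
the multilinear algebra of `ContinuousAlternatingMap.iterWedgeAlt` expects). [folklore] -/
def coordTupleAt (k : ℕ) (s : Fin k → Fin N) (z : A.carrier) : Fin k → E [⋀^Fin 1]→L[ℝ] ℂ :=
  fun i ↦ A.dAt (A.regularFun (x (s i))) z

/-- Along a `cons`-tuple the tuple of differentials is a `cons`-tuple. [folklore] -/
private theorem coordTupleAt_cons (p : ℕ) (l : Fin N) (t : Fin p → Fin N) (z : A.carrier) :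
    coordTupleAt A x (p + 1) (Fin.cons l t) z =
      Fin.cons (A.dAt (A.regularFun (x l)) z) (coordTupleAt A x p t z) := by
  funext i
  refine Fin.cases ?_ (fun j ↦ ?_) i
  · rfl
  · rfl

/-- Along `insertNth i l t` the tuple of differentials is the `cons l t` one permuted by the cycle
`Fin.cycleRange i` (`Fin.cons_comp_cycleRange`). [folklore] -/
private theorem coordTupleAt_insertNth (p : ℕ) (i : Fin (p + 1)) (l : Fin N) (t : Fin p → Fin N)
    (z : A.carrier) :
    coordTupleAt A x (p + 1) (Fin.insertNth (α := fun _ ↦ Fin N) i l t) z =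
      coordTupleAt A x (p + 1) (Fin.cons l t) z ∘ Fin.cycleRange i := by
  funext j
  simp only [coordTupleAt, Function.comp_apply, Fin.cons_apply_cycleRange]

/-- Pointwise, `dx_s^an` is the (alternating, multilinear) iterated wedge of the `1`-forms
`(dx_l^an)_z`. [cite: Warner1983, 2.13] -/
theorem coordWedge_apply (k : ℕ) (s : Fin k → Fin N) (z : A.carrier) :
    coordWedge A x k s z =
      ContinuousAlternatingMap.iterWedgeAlt ℝ E ℂ k (coordTupleAt A x k s z) := by
  rw [coordWedge, dWedge_apply]
  rfl

/-- The un-normalised holomorphic image `α ↦ Σ_t (φ_x α(e_t))^an · dx_t^an`, the sum over ALL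
`t : Fin p → Fin N` (`= p! ·` the usual sum over increasing `t`: both `α(e_t)` and the iterated
wedge are alternating in `t`). `ℂ`-linear. [cite: Grothendieck1966, (5)] -/
def rawRealize (p : ℕ) : PolyForm ℂ N p →ₗ[ℂ] MForm 𝓘(ℝ, E) A.carrier ℂ p where
  toFun α := ∑ t : Fin p → Fin N, fun z ↦
    A.regularFun (coordPresentation Y x (α (stdTuple t))) z • coordWedge A x p t z
  map_add' α₁ α₂ := by
    rw [← Finset.sum_add_distrib]
    refine Finset.sum_congr rfl fun t _ ↦ ?_
    funext z
    simp only [AlternatingMap.add_apply, map_add, AnalyticModel.regularFun_add, Pi.add_apply]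
    rw [add_smul]
  map_smul' c α := by
    rw [Finset.smul_sum]
    refine Finset.sum_congr rfl fun t _ ↦ ?_
    funext z
    simp only [AlternatingMap.smul_apply, MvPolynomial.smul_eq_C_mul, RingHom.id_apply,
      Pi.smul_apply, AnalyticModel.regularFun_coordPresentation_C_mul]
    rw [smul_smul]

/-- Unfolding `rawRealize` at a point. [cite: Grothendieck1966, (5)] -/
theorem rawRealize_apply (p : ℕ) (α : PolyForm ℂ N p) (z : A.carrier) :
    rawRealize A x p α z = ∑ t : Fin p → Fin N,
      A.regularFun (coordPresentation Y x (α (stdTuple t))) z • coordWedge A x p t z := by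
  simp only [rawRealize, LinearMap.coe_mk, AddHom.coe_mk, Finset.sum_apply]

/-- **The holomorphic image of a polynomial `p`-form** on `Y^an` along the coordinates `x`
[Grothendieck1966, (5)]: `α ↦ Σ_t (p!)⁻¹ (φ_x α(e_t))^an · dx_{t 0}^an ∧ ⋯ ∧ dx_{t (p-1)}^an`, the sum
over all `t : Fin p → Fin N` (over increasing `t` each term appears once; both `α(e_t)` and the
iterated wedge are alternating in `t`, so every rearrangement of an increasing `t` contributes the
same term and tuples with a repetition contribute `0`). `ℂ`-linear. [cite: Grothendieck1966, (5)] -/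
def polyFormRealize (p : ℕ) : PolyForm ℂ N p →ₗ[ℂ] MForm 𝓘(ℝ, E) A.carrier ℂ p :=
  ((p.factorial : ℂ)⁻¹) • rawRealize A x p

/-- `polyFormRealize = (p!)⁻¹ · rawRealize`. [cite: Grothendieck1966, (5)] -/
theorem polyFormRealize_eq_smul (p : ℕ) (α : PolyForm ℂ N p) :
    polyFormRealize A x p α = ((p.factorial : ℂ)⁻¹) • rawRealize A x p α :=
  rfl

/-- Unfolding `polyFormRealize` at a point. [cite: Grothendieck1966, (5)] -/
theorem polyFormRealize_apply (p : ℕ) (α : PolyForm ℂ N p) (z : A.carrier) :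
    polyFormRealize A x p α z = ∑ t : Fin p → Fin N,
      ((p.factorial : ℂ)⁻¹ * A.regularFun (coordPresentation Y x (α (stdTuple t))) z) •
        coordWedge A x p t z := by
  rw [polyFormRealize_eq_smul, Pi.smul_apply, rawRealize_apply, Finset.smul_sum]
  exact Finset.sum_congr rfl fun t _ ↦ by rw [smul_smul]

/-- **`ℂ[T]`-semilinearity**: `(f α)^an = (φ_x f)^an · α^an`. [cite: Grothendieck1966, (5)] -/
theorem rawRealize_smul (p : ℕ) (f : MvPolynomial (Fin N) ℂ) (α : PolyForm ℂ N p) :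
    rawRealize A x p (f • α) =
      fun z ↦ A.regularFun (coordPresentation Y x f) z • rawRealize A x p α z := by
  funext z
  rw [rawRealize_apply, rawRealize_apply, Finset.smul_sum]
  refine Finset.sum_congr rfl fun t _ ↦ ?_
  rw [AlternatingMap.smul_apply, smul_eq_mul, map_mul, AnalyticModel.regularFun_mul', smul_smul]

/-- **`ℂ[T]`-semilinearity**: `(f α)^an = (φ_x f)^an · α^an`. [cite: Grothendieck1966, (5)] -/
theorem polyFormRealize_smul (p : ℕ) (f : MvPolynomial (Fin N) ℂ) (α : PolyForm ℂ N p) :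
    polyFormRealize A x p (f • α) =
      fun z ↦ A.regularFun (coordPresentation Y x f) z • polyFormRealize A x p α z := by
  funext z
  rw [polyFormRealize_eq_smul, polyFormRealize_eq_smul, rawRealize_smul, Pi.smul_apply,
    Pi.smul_apply, smul_comm]

/-- In degree `0` the holomorphic image of `f` is the function `(φ_x f)^an`. [cite: Grothendieck1966, (5)] -/
theorem polyFormRealize_ofPoly (f : MvPolynomial (Fin N) ℂ) :
    polyFormRealize A x 0 (ofPoly f) =
      MForm.ofFun 𝓘(ℝ, E) (A.regularFun (coordPresentation Y x f)) := by
  funext z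
  rw [polyFormRealize_apply, Fintype.sum_unique]
  ext v
  simp [dWedge]

/-! ### The symbolic expression of a polynomial form -/

/-- **The algebraic form expression of a polynomial form** along the coordinates `x`: the formal
sum `Σ_t (p!)⁻¹ φ_x(α(e_t)) · dx_{t 0} ∧ ⋯ ∧ dx_{t (p-1)}` (monomials enumerated by
`finFunctionFinEquiv`). [cite: Grothendieck1966, (5)] -/
def PolyForm.toAlgFormExpr {p : ℕ} (α : PolyForm ℂ N p) : AlgFormExpr Y p where
  size := N ^ p
  coef j := coordPresentation Y x
    (MvPolynomial.C ((p.factorial : ℂ)⁻¹) * α (stdTuple (finFunctionFinEquiv.symm j)))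
  arg j i := x (finFunctionFinEquiv.symm j i)

/-- **The realisation of the expression of `α` is the holomorphic image of `α`.** This is the
bridge between the symbolic carrier `AlgFormExpr` / `realize` and Kähler forms.
[cite: Grothendieck1966, (5)] -/
theorem realize_toAlgFormExpr {p : ℕ} (α : PolyForm ℂ N p) :
    (PolyForm.toAlgFormExpr x α).realize A = polyFormRealize A x p α := by
  funext z
  rw [polyFormRealize_apply]
  unfold AlgFormExpr.realize PolyForm.toAlgFormExpr
  rw [Finset.sum_apply]
  exact Fintype.sum_equiv finFunctionFinEquiv.symm _ _ fun j ↦ by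
    rw [AnalyticModel.regularFun_coordPresentation_C_mul]

end Realize

section ChainRule

variable [IsAffine Y.left] (A : AnalyticModel E m Y) (x : Fin N → Γ(Y.left, ⊤))

/-- **Chain rule for polynomials in the coordinates**:
`d (φ_x f)^an = Σ_l (φ_x ∂f/∂T_l)^an · d x_l^an` (induction on `f`: constants, sums, and the Leibniz
rule for `f · T_l`). [cite: Warner1983, 2.20] -/
theorem dFun_regularFun_coordPresentation (f : MvPolynomial (Fin N) ℂ) :
    (dFun (A.regularFun (coordPresentation Y x f)) : MForm 𝓘(ℝ, E) A.carrier ℂ 1) =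
      ∑ l : Fin N, fun z ↦ A.regularFun (coordPresentation Y x (MvPolynomial.pderiv l f)) z •
        (dFun (A.regularFun (x l)) : MForm 𝓘(ℝ, E) A.carrier ℂ 1) z := by
  induction f using MvPolynomial.induction_on with
  | C c =>
    rw [coordPresentation_C, AnalyticModel.regularFun_scalarRingHom, dFun_const]
    symm
    refine Finset.sum_eq_zero fun l _ ↦ ?_
    funext z
    rw [MvPolynomial.pderiv_C, map_zero, AnalyticModel.regularFun_zero, zero_smul]
    rfl
  | add f g hf hg =>
    rw [map_add, AnalyticModel.regularFun_add,
      dFun_add (A.contMDiff_regularFun _) (A.contMDiff_regularFun _), hf, hg,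
      ← Finset.sum_add_distrib]
    refine Finset.sum_congr rfl fun l _ ↦ ?_
    funext z
    rw [map_add, map_add, AnalyticModel.regularFun_add, Pi.add_apply, add_smul]
  | mul_X f l hf =>
    rw [map_mul, coordPresentation_X, AnalyticModel.regularFun_mul',
      dFun_mul (A.contMDiff_regularFun _) (A.contMDiff_regularFun _), hf]
    funext z
    simp only [Finset.sum_apply, MvPolynomial.pderiv_mul, MvPolynomial.pderiv_X, map_add, map_mul,
      coordPresentation_X, AnalyticModel.regularFun_add, AnalyticModel.regularFun_mul', add_smul,
      Finset.sum_add_distrib, Finset.smul_sum, smul_smul]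
    congr 1
    · exact Finset.sum_congr rfl fun l' _ ↦ by rw [mul_comm]
    · rw [Finset.sum_eq_single l (fun l' _ hl' ↦ by
          rw [Pi.single_eq_of_ne' hl', map_zero, AnalyticModel.regularFun_zero, mul_zero, zero_smul])
        (fun h ↦ absurd (Finset.mem_univ l) h)]
      rw [Pi.single_eq_same, map_one, AnalyticModel.regularFun_one', mul_one]

/-- The chain rule at a point, on the model space: `(d(φ_x f)^an)_z = Σ_l (φ_x ∂_l f)^an(z) (dx_l^an)_z`.
[cite: Warner1983, 2.20] -/
theorem dAt_regularFun_coordPresentation (f : MvPolynomial (Fin N) ℂ) (z : A.carrier) :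
    A.dAt (A.regularFun (coordPresentation Y x f)) z =
      ∑ l : Fin N, A.regularFun (coordPresentation Y x (MvPolynomial.pderiv l f)) z •
        A.dAt (A.regularFun (x l)) z := by
  unfold AnalyticModel.dAt
  rw [dFun_regularFun_coordPresentation, Finset.sum_apply]
  rfl

end ChainRule

/-! ### The holomorphic image is a cochain map -/

section Cochain

/-- A multilinear map applied to a tuple whose first entry is a linear combination
(iterated `MultilinearMap.cons_add` / `cons_smul`). [folklore] -/
private theorem multilinear_cons_sum_smul {R : Type*} [CommSemiring R] {n : ℕ}
    {M : Fin n.succ → Type*} {M₂ : Type*} [∀ i, AddCommMonoid (M i)] [AddCommMonoid M₂]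
    [∀ i, Module R (M i)] [Module R M₂] (f : MultilinearMap R M M₂) (q : ∀ i : Fin n, M i.succ)
    {ι : Type*} (S : Finset ι) (c : ι → R) (v : ι → M 0) :
    f (Fin.cons (∑ l ∈ S, c l • v l) q) = ∑ l ∈ S, c l • f (Fin.cons (v l) q) := by
  classical
  induction S using Finset.induction_on with
  | empty =>
    rw [Finset.sum_empty, Finset.sum_empty, ← zero_smul R (0 : M 0), MultilinearMap.cons_smul,
      zero_smul]
  | insert a S ha ih =>
    rw [Finset.sum_insert ha, Finset.sum_insert ha, MultilinearMap.cons_add,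
      MultilinearMap.cons_smul, ih]

/-- `Fin.insertNthEquiv` on a pair (definitional unfolding). [folklore] -/
private theorem insertNthEquiv_pair {p : ℕ} (i : Fin (p + 1)) (l : Fin N) (t : Fin p → Fin N) :
    (Fin.insertNthEquiv (fun _ ↦ Fin N) i) (l, t) = Fin.insertNth (α := fun _ ↦ Fin N) i l t :=
  rfl

variable (A : AnalyticModel E m Y) (x : Fin N → Γ(Y.left, ⊤))

/-- Reading the alternatised formula for `dα` on `Y^an`:
`(φ_x (dα)(e_s))^an = Σᵢ (−1)ⁱ (φ_x ∂_{sᵢ} α(e_{s∘succAboveᵢ}))^an`. [folklore] -/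
private theorem regularFun_extDeriv_stdTuple (p : ℕ) (α : PolyForm ℂ N p)
    (s : Fin (p + 1) → Fin N) (z : A.carrier) :
    A.regularFun (coordPresentation Y x (extDeriv α (stdTuple s))) z =
      ∑ i : Fin (p + 1), (-1) ^ (i : ℕ) * A.regularFun (coordPresentation Y x
        (MvPolynomial.pderiv (s i) (α (stdTuple (i.removeNth s))))) z := by
  rw [AffineDeRham.extDeriv_apply, map_sum, AnalyticModel.regularFun_sum]
  refine Finset.sum_congr rfl fun i _ ↦ ?_
  have hneg : A.regularFun (coordPresentation Y x ((-1) ^ (i : ℕ))) z = (-1) ^ (i : ℕ) := by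
    rw [map_pow, map_neg, map_one, ← AnalyticModel.regularFunRingHom_apply, map_pow, map_neg,
      map_one]
    rfl
  have hd : dirDeriv (stdTuple s i) (α (i.removeNth (stdTuple s))) =
      MvPolynomial.pderiv (s i) (α (stdTuple (i.removeNth s))) := by
    rw [show stdTuple s i = Pi.single (s i) 1 from rfl, dirDeriv_single]
    rfl
  rw [map_mul, AnalyticModel.regularFun_mul_apply, hneg, hd]

/-- **The monomial form along `insertNth i l t` is `(−1)ⁱ` times the one along `cons l t`**
(alternation of the iterated wedge under the cycle `Fin.cycleRange i`, of sign `(−1)ⁱ`).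
[cite: Warner1983, 2.20] -/
theorem coordWedge_insertNth (p : ℕ) (i : Fin (p + 1)) (l : Fin N) (t : Fin p → Fin N) :
    coordWedge A x (p + 1) (Fin.insertNth (α := fun _ ↦ Fin N) i l t) =
      ((-1 : ℂ) ^ (i : ℕ)) • coordWedge A x (p + 1) (Fin.cons l t) := by
  classical
  funext z
  rw [coordWedge_apply, coordTupleAt_insertNth, AlternatingMap.map_perm, Fin.sign_cycleRange,
    Units.smul_def, Units.val_pow_eq_pow_val, Units.val_neg, Units.val_one,
    ← Int.cast_smul_eq_zsmul ℂ, Int.cast_pow, Int.cast_neg, Int.cast_one, Pi.smul_apply,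
    coordWedge_apply]
  rfl

variable [IsAffine Y.left]

/-- **`d` of one analytic monomial term**:
`d((φ_x f)^an · dx_t^an) = Σ_l (φ_x ∂f/∂T_l)^an · dx_l^an ∧ dx_t^an`
(`d(u · dg₁ ∧ ⋯) = du ∧ dg₁ ∧ ⋯`, the chain rule for `du`, and multilinearity of the iterated wedge
in its first slot). [cite: Warner1983, 2.20] -/
theorem mextDeriv_regularFun_smul_coordWedge (p : ℕ) (f : MvPolynomial (Fin N) ℂ)
    (t : Fin p → Fin N) :
    mextDeriv (fun z ↦ A.regularFun (coordPresentation Y x f) z • coordWedge A x p t z :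
        MForm 𝓘(ℝ, E) A.carrier ℂ p) =
      ∑ l : Fin N, fun z ↦ A.regularFun (coordPresentation Y x (MvPolynomial.pderiv l f)) z •
        coordWedge A x (p + 1) (Fin.cons l t) z := by
  rw [coordWedge,
    mextDeriv_funSmul_dWedge (A.contMDiff_regularFun _) (fun i ↦ A.contMDiff_regularFun _)]
  funext z
  have hcons : Fin.cons (A.dAt (A.regularFun (coordPresentation Y x f)) z) (coordTupleAt A x p t z) =
      (fun i ↦ (dFun (Fin.cons (α := fun _ ↦ A.carrier → ℂ)
        (A.regularFun (coordPresentation Y x f)) (fun i ↦ A.regularFun (x (t i))) i) :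
          MForm 𝓘(ℝ, E) A.carrier ℂ 1) z) := by
    funext i
    refine Fin.cases ?_ (fun j ↦ ?_) i
    · rfl
    · rfl
  have hmul := multilinear_cons_sum_smul
    ((ContinuousAlternatingMap.iterWedgeAlt ℝ E ℂ (p + 1) :
      (E [⋀^Fin 1]→L[ℝ] ℂ) [⋀^Fin (p + 1)]→ₗ[ℂ] (E [⋀^Fin (p + 1)]→L[ℝ] ℂ)) :
      MultilinearMap ℂ (fun _ : Fin (p + 1) ↦ E [⋀^Fin 1]→L[ℝ] ℂ) (E [⋀^Fin (p + 1)]→L[ℝ] ℂ))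
    (coordTupleAt A x p t z) Finset.univ
    (fun l ↦ A.regularFun (coordPresentation Y x (MvPolynomial.pderiv l f)) z)
    (fun l ↦ A.dAt (A.regularFun (x l)) z)
  rw [dWedge_apply, ← hcons, dAt_regularFun_coordPresentation,
    ← ContinuousAlternatingMap.iterWedgeAlt_apply, Finset.sum_apply]
  refine hmul.trans (Finset.sum_congr rfl fun l _ ↦ ?_)
  show _ = A.regularFun (coordPresentation Y x (MvPolynomial.pderiv l f)) z •
    coordWedge A x (p + 1) (Fin.cons l t) z
  rw [coordWedge_apply, coordTupleAt_cons]
  rfl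

/-- `d` of the un-normalised holomorphic image, term by term. [cite: Warner1983, 2.20] -/
theorem mextDeriv_rawRealize (p : ℕ) (α : PolyForm ℂ N p) :
    mextDeriv (rawRealize A x p α) = ∑ t : Fin p → Fin N, ∑ l : Fin N,
      fun z ↦ A.regularFun (coordPresentation Y x (MvPolynomial.pderiv l (α (stdTuple t)))) z •
        coordWedge A x (p + 1) (Fin.cons l t) z := by
  have hs : ∀ t ∈ (Finset.univ : Finset (Fin p → Fin N)), ∀ z : A.carrier,
      MForm.SmoothAt (fun z ↦ A.regularFun (coordPresentation Y x (α (stdTuple t))) z •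
        coordWedge A x p t z : MForm 𝓘(ℝ, E) A.carrier ℂ p) z :=
    fun t _ z ↦ MForm.smoothAt_funSmul ((A.contMDiff_regularFun _) z)
      (smoothAt_dWedge (fun i ↦ A.contMDiff_regularFun _) z)
  funext z
  rw [show rawRealize A x p α = ∑ t : Fin p → Fin N, (fun z ↦
      A.regularFun (coordPresentation Y x (α (stdTuple t))) z • coordWedge A x p t z :
        MForm 𝓘(ℝ, E) A.carrier ℂ p) from rfl,
    mextDeriv_sum_apply_of_smoothAt _ (fun t ht ↦ hs t ht z), Finset.sum_apply]
  exact Finset.sum_congr rfl fun t _ ↦ by rw [mextDeriv_regularFun_smul_coordWedge]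

/-- **The holomorphic image is a cochain map (un-normalised form)**:
`raw(dα) = (p + 1) · d(raw α)`. Expand `dα` by the alternatised formula, reindex the tuples
`s = insertNth i l t`, and use `dx_{insertNth i l t} = (−1)ⁱ dx_{cons l t}`: each of the `p + 1`
values of `i` contributes `d(raw α)`. [cite: Grothendieck1966, (5)] -/
theorem rawRealize_extDeriv (p : ℕ) (α : PolyForm ℂ N p) :
    rawRealize A x (p + 1) (extDeriv α) = ((p + 1 : ℕ) : ℂ) • mextDeriv (rawRealize A x p α) := by
  classical
  funext z
  rw [rawRealize_apply, mextDeriv_rawRealize, Pi.smul_apply]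
  simp only [regularFun_extDeriv_stdTuple, Finset.sum_smul, Finset.sum_apply]
  rw [Finset.sum_comm]
  have hi : ∀ i : Fin (p + 1),
      ∑ s : Fin (p + 1) → Fin N, ((-1) ^ (i : ℕ) * A.regularFun (coordPresentation Y x
          (MvPolynomial.pderiv (s i) (α (stdTuple (i.removeNth s))))) z) •
            coordWedge A x (p + 1) s z =
        ∑ t : Fin p → Fin N, ∑ l : Fin N, A.regularFun (coordPresentation Y x
          (MvPolynomial.pderiv l (α (stdTuple t)))) z • coordWedge A x (p + 1) (Fin.cons l t) z := by
    intro i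
    rw [← (Fin.insertNthEquiv (fun _ ↦ Fin N) i).sum_comp, Fintype.sum_prod_type,
      Finset.sum_comm]
    refine Finset.sum_congr rfl fun t _ ↦ Finset.sum_congr rfl fun l _ ↦ ?_
    rw [insertNthEquiv_pair, Fin.insertNth_apply_same, Fin.removeNth_insertNth,
      coordWedge_insertNth, Pi.smul_apply, smul_smul, mul_comm ((-1 : ℂ) ^ (i : ℕ)), mul_assoc,
      ← mul_pow, neg_one_mul, neg_neg, one_pow, mul_one]
  simp only [hi, Finset.sum_const, Finset.card_univ, Fintype.card_fin, ← Nat.cast_smul_eq_nsmul ℂ]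

/-- **The holomorphic image of polynomial forms is a cochain map**:
`(dα)^an = d(α^an)` [Grothendieck1966, (5): "restriction of algebraic to holomorphic forms is
compatible with `d`"]. [cite: Grothendieck1966, (5)] -/
theorem polyFormRealize_extDeriv (p : ℕ) (α : PolyForm ℂ N p) :
    polyFormRealize A x (p + 1) (extDeriv α) = mextDeriv (polyFormRealize A x p α) := by
  have h : ((p + 1 : ℕ) : ℂ) ≠ 0 := Nat.cast_ne_zero.2 (Nat.succ_ne_zero p)
  rw [polyFormRealize_eq_smul, polyFormRealize_eq_smul, rawRealize_extDeriv, smul_smul,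
    mextDeriv_smul_complex_holds, Nat.factorial_succ, Nat.cast_mul, mul_inv, mul_right_comm,
    inv_mul_cancel₀ h, one_mul]

end Cochain

/-! ### Descent to regular forms on `V(I)` and the comparison map on cohomology -/

section Descent

variable [IsAffine Y.left] (A : AnalyticModel E m Y) (x : Fin N → Γ(Y.left, ⊤))

/-- The holomorphic image of a polynomial form is a smooth form. [cite: Grothendieck1966, (5)] -/
theorem isSmoothForm_polyFormRealize (p : ℕ) (α : PolyForm ℂ N p) :
    IsSmoothForm (polyFormRealize A x p α) := by
  rw [← realize_toAlgFormExpr]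
  exact (PolyForm.toAlgFormExpr x α).isSmoothForm_realize A

omit [IsAffine Y.left] in
/-- Forms in `I · Ω^p` with `I ⊆ ker φ_x` have zero holomorphic image (`(f α)^an = (φ_x f)^an α^an`
and `(φ_x f)^an = 0`). [folklore] -/
private theorem polyFormRealize_eq_zero_of_mem_smul_top {I : Ideal (MvPolynomial (Fin N) ℂ)}
    (hI : I ≤ RingHom.ker (coordPresentation Y x)) (p : ℕ) {α : PolyForm ℂ N p}
    (hα : α ∈ I • (⊤ : Submodule (MvPolynomial (Fin N) ℂ) (PolyForm ℂ N p))) :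
    polyFormRealize A x p α = 0 := by
  refine Submodule.smul_induction_on hα (fun f hf β _ ↦ ?_) (fun β γ hβ hγ ↦ ?_)
  · rw [polyFormRealize_smul, RingHom.mem_ker.1 (hI hf), AnalyticModel.regularFun_zero]
    funext z
    rw [zero_smul]
    rfl
  · rw [map_add, hβ, hγ, add_zero]

/-- **Forms vanishing on `V(I)` have zero holomorphic image on `Y^an`** when `I ⊆ ker φ_x` (i.e.
`Y(ℂ) ↪ V(I)` under the coordinates): by induction on the degree through the recursive description
`I·Ω⁰ = I`, `I·Ω^{p+1} + ℂ[T]·d(vanishing p-forms)`, using semilinearity and the cochain property.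
[cite: Grothendieck1966, (5)] -/
theorem polyFormRealize_eq_zero_of_mem_vanishingForms {I : Ideal (MvPolynomial (Fin N) ℂ)}
    (hI : I ≤ RingHom.ker (coordPresentation Y x)) :
    ∀ (p : ℕ) {α : PolyForm ℂ N p}, α ∈ vanishingForms I p → polyFormRealize A x p α = 0 := by
  intro p
  induction p with
  | zero =>
    intro α hα
    exact polyFormRealize_eq_zero_of_mem_smul_top A x hI 0 hα
  | succ p ih =>
    have hspan : ∀ γ ∈ Submodule.span (MvPolynomial (Fin N) ℂ)
        (AffineDeRham.extDeriv '' (vanishingForms I p : Set (PolyForm ℂ N p))),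
        polyFormRealize A x (p + 1) γ = 0 := by
      intro γ hγ
      induction hγ using Submodule.span_induction with
      | mem θ hθ =>
        obtain ⟨η, hη, rfl⟩ := hθ
        rw [polyFormRealize_extDeriv, ih hη, mextDeriv_zero]
      | zero => exact map_zero _
      | add θ₁ θ₂ _ _ h₁ h₂ => rw [map_add, h₁, h₂, add_zero]
      | smul f θ _ h =>
        rw [polyFormRealize_smul, h]
        funext z
        rw [Pi.zero_apply, smul_zero]
    intro α hα
    rw [vanishingForms] at hα
    obtain ⟨β, hβ, γ, hγ, rfl⟩ := Submodule.mem_sup.1 hα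
    rw [map_add, polyFormRealize_eq_zero_of_mem_smul_top A x hI (p + 1) hβ, zero_add, hspan γ hγ]

/-- **The holomorphic image of a regular form** on `V(I) ⊇ φ_x(Y)`: `polyFormRealize` descends to
`RegularForm I p = Ω^p_{ℂ[T]/ℂ} / (forms vanishing on V(I))` [Grothendieck1966, (5)], `ℂ`-linear.
[cite: Grothendieck1966, (5)] -/
def regularFormRealize {I : Ideal (MvPolynomial (Fin N) ℂ)}
    (hI : I ≤ RingHom.ker (coordPresentation Y x)) (p : ℕ) :
    RegularForm I p →ₗ[ℂ] MForm 𝓘(ℝ, E) A.carrier ℂ p :=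
  ((vanishingForms I p).restrictScalars ℂ).liftQ (polyFormRealize A x p)
      (fun _ hα ↦ LinearMap.mem_ker.2
        (polyFormRealize_eq_zero_of_mem_vanishingForms A x hI p hα)) ∘ₗ
    (Submodule.Quotient.restrictScalarsEquiv ℂ (vanishingForms I p)).symm.toLinearMap

/-- The holomorphic image of the restriction of `α` to `V(I)` is that of `α`. [cite: Grothendieck1966, (5)] -/
@[simp]
theorem regularFormRealize_mk {I : Ideal (MvPolynomial (Fin N) ℂ)}
    (hI : I ≤ RingHom.ker (coordPresentation Y x)) (p : ℕ) (α : PolyForm ℂ N p) :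
    regularFormRealize A x hI p (RegularForm.mk I α) = polyFormRealize A x p α :=
  rfl

/-- **The holomorphic image of regular forms commutes with `d`.** [cite: Grothendieck1966, (5)] -/
theorem regularFormRealize_d {I : Ideal (MvPolynomial (Fin N) ℂ)}
    (hI : I ≤ RingHom.ker (coordPresentation Y x)) (p : ℕ) (r : RegularForm I p) :
    regularFormRealize A x hI (p + 1) (RegularForm.d I r) =
      mextDeriv (regularFormRealize A x hI p r) := by
  obtain ⟨α, rfl⟩ := RegularForm.mk_surjective I r
  rw [RegularForm.d_mk, regularFormRealize_mk, regularFormRealize_mk, polyFormRealize_extDeriv]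

/-- The holomorphic image of a regular form is smooth. [cite: Grothendieck1966, (5)] -/
theorem isSmoothForm_regularFormRealize {I : Ideal (MvPolynomial (Fin N) ℂ)}
    (hI : I ≤ RingHom.ker (coordPresentation Y x)) (p : ℕ) (r : RegularForm I p) :
    IsSmoothForm (regularFormRealize A x hI p r) := by
  obtain ⟨α, rfl⟩ := RegularForm.mk_surjective I r
  rw [regularFormRealize_mk]
  exact isSmoothForm_polyFormRealize A x p α

/-- **Closed regular forms have closed holomorphic images.** [cite: Grothendieck1966, (5)] -/
theorem regularFormRealize_mem_cclosedSmoothForms {I : Ideal (MvPolynomial (Fin N) ℂ)}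
    (hI : I ≤ RingHom.ker (coordPresentation Y x)) (p : ℕ) {r : RegularForm I p}
    (hr : r ∈ closedForms I p) :
    regularFormRealize A x hI p r ∈ cclosedSmoothForms E A.carrier p := by
  refine mem_cclosedSmoothForms (isSmoothForm_regularFormRealize A x hI p r) ?_
  rw [IsClosedForm, ← regularFormRealize_d, LinearMap.mem_ker.1 hr, map_zero]

/-- **Exact regular forms have exact holomorphic images.** [cite: Grothendieck1966, (5)] -/
theorem regularFormRealize_mem_cexactSmoothForms {I : Ideal (MvPolynomial (Fin N) ℂ)}
    (hI : I ≤ RingHom.ker (coordPresentation Y x)) :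
    ∀ (p : ℕ) {r : RegularForm I p}, r ∈ exactForms I p →
      regularFormRealize A x hI p r ∈ cexactSmoothForms E A.carrier p
  | 0, r, hr => by
    rw [exactForms, Submodule.mem_bot] at hr
    rw [hr, map_zero]
    exact Submodule.zero_mem _
  | p + 1, r, hr => by
    obtain ⟨r', rfl⟩ := LinearMap.mem_range.1 hr
    rw [regularFormRealize_d, cexactSmoothForms]
    exact Submodule.subset_span ⟨_, (mem_csmoothForms_iff _).2
      (isSmoothForm_regularFormRealize A x hI p r'), rfl⟩

/-- **Grothendieck's comparison map** [Grothendieck1966, (5)]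
`H^p_dR(V(I)/ℂ) = H^p(Γ(Ω•)) → H^p_dR(Y^an; ℂ)`, induced by the holomorphic image of regular forms
(closed to closed, exact to exact); for `φ_x` surjective, `I = ker φ_x` and `Y` smooth, Theorem 1′
ibid. asserts that it is bijective. [cite: Grothendieck1966, (5)] -/
def deRhamComparison {I : Ideal (MvPolynomial (Fin N) ℂ)}
    (hI : I ≤ RingHom.ker (coordPresentation Y x)) (p : ℕ) :
    DeRhamCohomology I p →ₗ[ℂ] complexDeRhamCohomology E A.carrier p :=
  Submodule.mapQ _ _
    ((regularFormRealize A x hI p).restrict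
      (fun _ hr ↦ regularFormRealize_mem_cclosedSmoothForms A x hI p hr))
    (fun _ hr ↦ regularFormRealize_mem_cexactSmoothForms A x hI p hr)

/-- The comparison map on a class: `[r] ↦ [r^an]`. [cite: Grothendieck1966, (5)] -/
theorem deRhamComparison_mk {I : Ideal (MvPolynomial (Fin N) ℂ)}
    (hI : I ≤ RingHom.ker (coordPresentation Y x)) (p : ℕ) (r : closedForms I p) :
    deRhamComparison A x hI p (DeRhamCohomology.mk I r) =
      complexDeRhamCohomology.mk E A.carrier p
        ⟨regularFormRealize A x hI p r, regularFormRealize_mem_cclosedSmoothForms A x hI p r.2⟩ :=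
  rfl

/-- **From Theorem 1′ to (G).** If for some coordinates `x` and some `I ⊆ ker φ_x` the comparison
map (5) is surjective in degree `p`, then every complex de Rham class of `Y^an` in degree `p` is
the class of the realisation of an algebraic `p`-form expression on `Y` — the conclusion of the
named fact `grothendieck_comparison_realize_surjective` for `(Y, A, p)`.
[cite: Grothendieck1966, Thm 1′] -/
theorem exists_realize_eq_of_deRhamComparison_surjective {I : Ideal (MvPolynomial (Fin N) ℂ)}
    (hI : I ≤ RingHom.ker (coordPresentation Y x)) {p : ℕ}
    (hsurj : Function.Surjective (deRhamComparison A x hI p))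
    (c : complexDeRhamCohomology E A.carrier p) :
    ∃ (ξ : AlgFormExpr Y p) (hξ : ξ.realize A ∈ cclosedSmoothForms E A.carrier p),
      complexDeRhamCohomology.mk E A.carrier p ⟨ξ.realize A, hξ⟩ = c := by
  obtain ⟨γ, rfl⟩ := hsurj c
  obtain ⟨r, rfl⟩ := DeRhamCohomology.mk_surjective I γ
  obtain ⟨α, hα⟩ := RegularForm.mk_surjective I (r : RegularForm I p)
  have hreal : (PolyForm.toAlgFormExpr x α).realize A = regularFormRealize A x hI p r := by
    rw [realize_toAlgFormExpr, ← regularFormRealize_mk A x hI, hα]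
  refine ⟨PolyForm.toAlgFormExpr x α,
    hreal ▸ regularFormRealize_mem_cclosedSmoothForms A x hI p r.2, ?_⟩
  rw [deRhamComparison_mk]
  congr 1
  exact Subtype.ext hreal

omit [IsAffine Y.left] in
/-- **(G) from Theorem 1′, globally**: if for every smooth affine `Y`, analytic model `A` and degree
`k` some coordinates have a surjective comparison map (5), then
`grothendieck_comparison_realize_surjective` holds. [cite: Grothendieck1966, Thm 1′] -/
theorem grothendieck_comparison_realize_surjective_of_deRhamComparison
    (h : ∀ (m : ℕ) (Y : Motives.SchemeOver ℂ) [IsAffine Y.left] [SmoothOfRelativeDimension m Y.hom]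
      (E : Type) [NormedAddCommGroup E] [NormedSpace ℂ E] [FiniteDimensional ℂ E]
      (A : AnalyticModel E m Y) (k : ℕ),
      ∃ (N : ℕ) (x : Fin N → Γ(Y.left, ⊤)) (I : Ideal (MvPolynomial (Fin N) ℂ))
        (hI : I ≤ RingHom.ker (coordPresentation Y x)),
        Function.Surjective (deRhamComparison A x hI k)) :
    grothendieck_comparison_realize_surjective := by
  intro m Y _ _ E _ _ _ A k c
  obtain ⟨N, x, I, hI, hsurj⟩ := h m Y E A k
  exact exists_realize_eq_of_deRhamComparison_surjective A x hI hsurj c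

end Descent

/-! ### Wedge compatibility and the polynomial form of an expression -/

section Converse

variable [IsAffine Y.left] (A : AnalyticModel E m Y) (x : Fin N → Γ(Y.left, ⊤))

/-- **The holomorphic image of `df ∧ η` is `d(φ_x f)^an ∧ η^an`** (from the cochain property and the
two Leibniz rules, `d(f η) = df ∧ η + f dη` on polynomial forms and `d(u · β) = du ∧ β + u · dβ` on
smooth forms). [cite: Grothendieck1966, (5)] -/
theorem polyFormRealize_dWedge (p : ℕ) (f : MvPolynomial (Fin N) ℂ) (η : PolyForm ℂ N p) :
    polyFormRealize A x (p + 1) (AffineDeRham.dWedge f η) =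
      ((dFun (A.regularFun (coordPresentation Y x f)) : MForm 𝓘(ℝ, E) A.carrier ℂ 1).wedge
        (polyFormRealize A x p η)).castDeg (Nat.add_comm 1 p) := by
  haveI : WedgeFacts 𝓘(ℝ, E) A.carrier ℂ :=
    wedgeFacts_of_comm (ContinuousAlternatingMap.WedgeComm_holds ℝ E ℂ)
  have hfs : IsSmoothForm (MForm.ofFun 𝓘(ℝ, E) (A.regularFun (coordPresentation Y x f))) :=
    fun z ↦ MForm.smoothAt_ofFun_of_contMDiffAt (A.contMDiff_regularFun _ z)
  have hR : IsSmoothForm (polyFormRealize A x p η) := isSmoothForm_polyFormRealize A x p η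
  have h1 : AffineDeRham.dWedge f η = extDeriv (f • η) - f • extDeriv η :=
    eq_sub_of_add_eq (extDeriv_smul f η).symm
  rw [h1, map_sub, polyFormRealize_extDeriv, polyFormRealize_smul, polyFormRealize_smul,
    polyFormRealize_extDeriv, funSmul_eq_castDeg_ofFun_wedge _ (polyFormRealize A x p η),
    mextDeriv_castDeg, mextDeriv_wedge hfs hR, pow_zero, one_smul, MForm.castDeg_add,
    MForm.ofFun_wedge, MForm.castDeg_castDeg, MForm.castDeg_castDeg, MForm.castDeg_eq_self,
    add_sub_cancel_right]
  rfl

/-- The polynomial form `da₀ ∧ ⋯ ∧ da_{k-1}` (`1` for `k = 0`) of a tuple of polynomials, by the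
same right-bracketed recursion as `HodgeTheory.dWedge`. [cite: Grothendieck1966, (4)] -/
def polyWedge : (k : ℕ) → (Fin k → MvPolynomial (Fin N) ℂ) → PolyForm ℂ N k
  | 0, _ => ofPoly 1
  | k + 1, a => AffineDeRham.dWedge (a 0) (polyWedge k (Fin.tail a))

/-- **`(da₀ ∧ ⋯ ∧ da_{k-1})^an = d(φ_x a₀)^an ∧ ⋯ ∧ d(φ_x a_{k-1})^an`.** [cite: Grothendieck1966, (5)] -/
theorem polyFormRealize_polyWedge (k : ℕ) (a : Fin k → MvPolynomial (Fin N) ℂ) :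
    polyFormRealize A x k (polyWedge k a) =
      dWedge k (fun i ↦ A.regularFun (coordPresentation Y x (a i))) := by
  induction k with
  | zero =>
    rw [polyWedge, polyFormRealize_ofPoly, map_one, AnalyticModel.regularFun_one']
    rfl
  | succ k ih =>
    rw [polyWedge, polyFormRealize_dWedge, ih]
    rfl

/-- **Every algebraic form expression is the holomorphic image of a polynomial form** when the
coordinates generate `Γ(Y, 𝒪)` (`φ_x` surjective): lift coefficients and arguments and take
`Σⱼ fⱼ · da_{j,0} ∧ ⋯ ∧ da_{j,p-1}`. Together with `realize_toAlgFormExpr`: the realisations of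
expressions are exactly the holomorphic images of polynomial (equivalently, regular) forms.
[cite: Grothendieck1966, (4)] -/
theorem exists_polyFormRealize_eq_realize (hφ : Function.Surjective (coordPresentation Y x))
    {p : ℕ} (ξ : AlgFormExpr Y p) :
    ∃ α : PolyForm ℂ N p, polyFormRealize A x p α = ξ.realize A := by
  choose F hF using hφ
  refine ⟨∑ j : Fin ξ.size, F (ξ.coef j) • polyWedge p (fun i ↦ F (ξ.arg j i)), ?_⟩
  rw [map_sum]
  unfold AlgFormExpr.realize
  refine Finset.sum_congr rfl fun j _ ↦ ?_
  rw [polyFormRealize_smul, polyFormRealize_polyWedge, hF]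
  simp only [hF]

/-- The same for regular forms on `V(I)`, `I ⊆ ker φ_x`. [cite: Grothendieck1966, (4)] -/
theorem exists_regularFormRealize_eq_realize (hφ : Function.Surjective (coordPresentation Y x))
    {I : Ideal (MvPolynomial (Fin N) ℂ)} (hI : I ≤ RingHom.ker (coordPresentation Y x))
    {p : ℕ} (ξ : AlgFormExpr Y p) :
    ∃ r : RegularForm I p, regularFormRealize A x hI p r = ξ.realize A := by
  obtain ⟨α, hα⟩ := exists_polyFormRealize_eq_realize A x hφ ξ
  exact ⟨RegularForm.mk I α, hα⟩

end Converse

end HodgeTheory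

end Literature.AlgebraicGeometry.HodgeTheory

end
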